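import Summits.BirchSwinnertonDyer.Rank1Residual.Supersingular.X6RankOneOneSided
import Summits.BirchSwinnertonDyer.Rank1Residual.Partition.Rows
import Literature.NumberTheory.EllipticCurves.JetchevSkinnerWan2017.RankOneLowerBound
import Literature.NumberTheory.EllipticCurves.Rank1Residual.Dedup
import HarnessLib

/-!
# Class X6 (good supersingular, semistable), analytic rank `1`: `BSD(E,p)` from
# Jetchev–Skinner–Wan 2017 §7.4.1 (eq:shalower) (lower half, named fact A155 — tier PUB[α]; at a
# supersingular `p` NOT a published input under the cell's rule, referee R123.1, see "TIER" below)
# + Sprung 2024 Cor. 1.3 (ii) (upper half) — the flag `JSW-ss`'s unpublished component (β) is NOT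
# used (cell `b2b-bsdres`, literature typer seat `lit-cw`, gen 3; TIER note gen 4; companion of
# `Supersingular/X6RankOneStepL.lean`, the same lower half from STEP L in the kernel)

HONEST FRAMING (cell `b2b-bsdres`, run/shared/lean/b2b/bsd-rank1-residual/, verbatim in every
file): the goal of the cell is to DELETE the COMBINATION-SHAPED residual classes of the
Birch–Swinnerton-Dyer formula for ALL analytic-rank `≤ 1` elliptic curves over `ℚ` — "full BSD
formula for every rank `≤ 1` curve in class `C`" assembled STRICTLY from published theorems — so
that the rank-`≤ 1` remainder becomes exactly the CONSTRUCTION-SHAPED classes, which are TYPED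
(missing-input `Prop`s), NOT attempted. This is not "finishing BSD". Research routes; no claim
beyond stated classes. THEOREMS ONLY (no definition, no named fact); nothing about any curve is
asserted; nothing is booked; no label is moved by this file (the referee rules). NEW WORK of the
cell (compositions of decls already in the tree), hence under `Summits/`.

## What this file records (numbers/decls, not adjectives)

The class `ClassX6 W p := GoodSS W p ∧ Semistable W ∧ (5 ≤ p ∨ a_3 = 0)` in analytic rank `1`.
Its cover of record is Jetchev–Skinner–Wan, Camb. J. Math. 5 (2017) Thm. 1.2.1 (tree fact
`JetchevSkinnerWan2017.thm121_padicValRat_bsd_rank_one`, `Typed.X6.bsdp_of_analyticRank_eq_one`),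
tier PUB* under the census flag `JSW-ss` ("its supersingular case imports X. Wan's ± divisibility",
now Burungale–Skinner–Tian–Wan arXiv:2409.01350, a PREPRINT on 2026-08-20). Reading the printed
proof (arXiv:1512.06894 §1.3 pp. 4–5, §7.4 pp. 29–31; this seat's CASTELLA-WAN.md §0.7–§0.10):

* §7.4.1 proves the LOWER bound (eq:shalower) `ord_p #Ш(E/ℚ)[p^∞] ≥ ord_p(L'(E,1)/(Ω·Reg·∏c_ℓ))`
  from (α) the anticyclotomic divisibility §6.1 Thm. ([wan:rankin], [wan:rankin-ss]) — at a
  supersingular `p` [wan:rankin-ss] = arXiv:1412.1767 (unpublished; "completely re-written … as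
  arXiv:2109.08375" = Castella–Liu–Wan, Forum Math. Sigma 10 (2022) e110 Thm. 8.2.3, whose
  statement does NOT match JSW's §6.1 theorem verbatim — referee R123.1: Δ1 "if `2` does not split in
  `𝒦` then `π` ramified at `2`" absent from JSW's (a)–(d), Δ2 ring `𝔭ℛ` vs `Λ[1/p]` — and which carries
  the travelling flag `Hid04-gap` (authors' unrefereed 2024 addendum after the [Hid04, Thm. 3.2] gap),
  as does its E-level form Castella–Wan, Math. Ann. 389 (2024) Thm. 5.3) —, Brooks' `p`-adic
  Waldspurger formula, Burungale's `μ = 0`, the general Gross–Zagier formula, and "Kato has proved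
  that the predicted upper bound holds for `#Ш(E^{D'}/ℚ)[p^∞]`" (Thm. 7.2.1 (i), [perrin-riou:expmath])
  for the FIRST auxiliary twist;
* §7.4.2 proves the UPPER bound (eq:shaupper) from Kolyvagin + Gross–Zagier + the rank-`0`
  `p`-part EQUALITY for the SECOND auxiliary twist `E^{D''}` (Thm. 7.2.1 (iii): "[skinner-urban:gl2]
  and [skinner:multred] for the ordinary case and [wan:kobayashi] for the supersingular case") —
  this is where, and ONLY where, component (β) = [wan:kobayashi] → BSTW Thm. 1.5 (PRE) enters
  (§1.3: "It is only at the final step, where we invoke the `p`-part of the BSD formula for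
  `L(E^{D''},1)` …"; §7.4.4 (iii)).

The cell ALREADY has the upper half on X6 ∧ {r_an = 1} at every odd `p` from refereed print that is
`JSW-ss`-free: Sprung, Adv. Math. 449 (2024) Cor. 1.3, second sentence (tree fact
`Sprung2024.cor13_padicValRat_bsd_rank_one_le`, flags `Sprung24-Cor13-via-Kob13` /
`KOB13-primary-unread`; `Supersingular/X6RankOneOneSided.lean`:
`X6.bsdp_of_missingLowerBoundAt_of_analyticRank_eq_one` — the typed residue on X6 ∧ {r_an = 1} IS
`Typed.MissingLowerBoundAt W p`). Hence:

§1 (from the cited statement). GRANTED the named fact A155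
`JetchevSkinnerWan2017.sec741_shaLowerBound_rank_one` (JSW's (eq:shalower) vendored verbatim; sibling
of `thm121`, same binders, weaker — `sec741_shaLowerBound_rank_one_of_thm121`; tier PUB[α], flag
`JSW17-741-ss-via-CLW22`: statement-match FAILS verbatim, referee R123.1 — so at a supersingular `p`
NOT a published input under the cell's rule), `X6.missingLowerBoundAt_of_sec741_of_analyticRank_eq_one`
delivers the typed residue and `X6.bsdp_of_sec741_of_sprung_of_analyticRank_eq_one` gives
`BSDp W p` for EVERY X6 pair with `p ≥ 3` and `ord_{s=1} L(E,s) = 1`, granted (eq:shalower), Sprung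
Cor. 1.3 (ii), GZK and modularity — by name; `RowC3.bsdp_of_goodSS_of_sec741_of_sprung` restates it on
the census row C3 ∩ {supersingular at `p`} (`Partition/Rows.lean`), the sub-row flagged `JSW-ss`. Reading for the referee (not asserted): on
X6 ∧ {r_an = 1} the PUB* component (β) of `JSW-ss` is not needed; what remains is (α) — GRADED by
the referee as NOT matching published print verbatim (R123.1, flag `JSW17-741-ss-via-CLW22`; plus
`Hid04-gap`) — and Sprung's reading flags. No label is moved here; X6 ∩ {r_an = 1} stays
CONSTRUCTION-SHAPED.

TIER (referee gen 119, ruling R123.1, HOME/REFEREE.md §C.1/§D; recorded here 2026-08-21,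
docstring-only, statements unchanged): A155 is ADMITTED at statement level with tier PUB[α] and the
flag `JSW17-741-ss-via-CLW22` GRADED "statement-match FAILS verbatim" — Δ1: Castella–Liu–Wan 2022
§5.2's standing condition "if `2` does not split in `𝒦`, then `π` is ramified at `2`" is not among
JSW §7.4.1 (a)–(d) for `K'`; Δ2: JSW's §6.1 theorem is asserted in `Λ_{𝒦,R}[1/p]`, CLW22 Thm. 8.2.3
(1) only in `ℛ = 𝒪^ur⟦Γ_𝒦⟧ ⊗_{𝒪⟦Γ_𝒦^+⟧} Frac(𝒪⟦Γ_𝒦^+⟧)`. Hence, under the cell's rule, the input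
`h741` of the §1 theorems is NOT a published theorem at a supersingular `p`: every theorem of this
file is CONDITIONAL on it, **X6 ∩ {r_an = 1} stays CONSTRUCTION-SHAPED** (its residue at a
supersingular `p` = the (α) anticyclotomic-divisibility input for JSW's `K'`, typed as STEP L in the
companion file), and `RowC3.bsdp_of_goodSS_of_sec741_of_sprung` books nothing. After the ruling this
seat recorded, for the referee only (CASTELLA-WAN.md §8; the companion docstring addendum in
`JetchevSkinnerWan2017/RankOneLowerBound.lean`): at the `E`-level and for `p ≥ 5` both deltas are
the subject of REFEREED print in Castella–Wan, Math. Ann. 389 (2024) — Δ2 in the proof of Thm. 5.3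
(display (5.2) "as fractional ideals in `Λ^ur ⊗_{ℤ_p⟦Γ_K^+⟧} Frac(ℤ_p⟦Γ_K^+⟧)`", descended to
`Λ_ac^ur[1/p]` in (5.3)–(5.4) via [SU14, Prop. 3.9] and Prop. 2.7; MS pp. 23–25), Δ1 in the proof
of Thm. 6.11 (choice of `K` with (a) (gen-H), (b) `q` non-split, (c) (spl), (d) "if `N` is odd, then
`2` splits in `K`", (e) `L(E^K,1) ≠ 0`, by [FH95, Thm. B]; MS p. 33) — leaving an object-by-object
concordance JSW Thm. 35/36 ↔ Castella–Wan (5.4)/Thm. 5.3 (tabulated there) and the travelling flag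
`Hid04-gap` (R123.2); `p = 3` (`a_3 = 0`) is outside Castella–Wan's `p ≥ 5`. The referee rules; this
file's tier is whatever the referee assigns to A155.

§2 lives in the companion file `Supersingular/X6RankOneStepL.lean` (p241685): the same lower half
re-derived in the kernel at a good supersingular `p ≥ 5` from STEP L (`X11b.IndexLowerBoundAt`, the
multr1 seats' typed input = JSW (eq:shalowerK-1); cell-lead currency caveat C186) + Wuthrich 2014
Prop. 21 for the Heegner twist + Gross–Zagier + Kolyvagin, with Sprung for the upper half — NO
rank-`0` `p`-part EQUALITY for any twist consumed there either.

References: Jetchev–Skinner–Wan 2017 §1.3, §7.2 Thm. 7.2.1, §7.4.1–7.4.4 [JetchevSkinnerWan2017];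
Sprung 2024 Cor. 1.3 [Sprung2024]; Wuthrich 2014 Prop. 21 [Wuthrich2014]; Castella–Wan 2024
Thm. 5.3 [CastellaWan2023]; Castella–Liu–Wan FMS 10 (2022) e110 Thm. 8.2.3; Perrin-Riou 2003
[PerrinRiou2003]; Burungale–Skinner–Tian–Wan arXiv:2409.01350 Thms. 1.3/1.5 [BurungaleSkinnerTianWan2024,
PRE]; Serre 1972 Props. 12, 21 [Serre1972]; Silverman AEC VII.5 Prop. 5.1 [SilvermanAEC2009];
Friedberg–Hoffstein 1995; Mazur 1978 Cor. 4.1; Miller 2011 Def. 1.1 [Miller2011LMS].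
-/

set_option autoImplicit false

noncomputable section

open scoped Classical MatrixGroups ModularForm

open CongruenceSubgroup WeierstrassCurve NumberField Literature.NumberTheory.EllipticCurves
  Literature.NumberTheory.EllipticCurves.ModularForms
  Literature.NumberTheory.EllipticCurves.Rank1Residual
  Literature.NumberTheory.EllipticCurves.Rank1Residual.Typed
  Literature.NumberTheory.EllipticCurves.Wuthrich2014

namespace Summit.BirchSwinnertonDyer.Rank1Residual.Supersingular

/-! ### §1 From the cited statement: JSW (eq:shalower) + Sprung Cor. 1.3 (ii) ⇒ `BSD(E,p)` on X6 ∧ {r_an = 1} -/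

/-- **The product-display inequality ⇒ the typed lower bound.** If `L^{(r)}(E,1)/r! = q·Reg·Ω_E`
with `q ∈ ℚ` and `ord_p q ≤ ord_p #Ш + ord_p ∏ c_ℓ` (the shape of JSW (eq:shalower)), `E[p]` is
irreducible (so `ord_p #E(ℚ)_tors = 0`, Mazur; tree `padicValNat_torsionOrder_eq_zero_of_irreducible`)
and `L^{(r)}(E,1) ≠ 0` (modularity `hmod`), then `#Ш_an = q·#tors²/∏c_ℓ` has `ord_p #Ш_an ≤ ord_p #Ш`,
i.e. `Typed.MissingLowerBoundAt W p`. Bookkeeping (the algebra of `bsdp_of_pPart`).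
[cite: JetchevSkinnerWan2017, §7.4.1 (eq:shalower)] [cite: Miller2011LMS, Def. 1.1] -/
theorem missingLowerBoundAt_of_productShape_le
    (W : WeierstrassCurve ℚ) [W.IsElliptic] [W.IsGloballyMinimal] (p : ℕ) [Fact p.Prime]
    (hmod : hasEntireLFunction_rat) (hirr : Irr W p)
    (h : ∃ q : ℚ, W.leadingLCoeff = (((q : ℝ) * W.regulator * W.realPeriodRat : ℝ) : ℂ) ∧
      padicValRat p q ≤ (padicValNat p W.shaOrder : ℤ) + padicValNat p W.tamagawaProduct) :
    MissingLowerBoundAt W p := by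
  obtain ⟨q, hq, hv⟩ := h
  have hΩ : (0 : ℝ) < W.realPeriodRat := W.realPeriodRat_pos_holds
  have hR : (0 : ℝ) < W.regulator := W.regulator_pos'
  have hc0 : 0 < W.tamagawaProduct := W.tamagawaProduct_pos_holds
  have ht0 : 0 < W.torsionOrder := W.torsionOrder_pos_holds
  have hΩ' : (W.realPeriodRat : ℂ) ≠ 0 := by exact_mod_cast hΩ.ne'
  have hR' : (W.regulator : ℂ) ≠ 0 := by exact_mod_cast hR.ne'
  have hcp : (W.tamagawaProduct : ℂ) ≠ 0 := by exact_mod_cast hc0.ne'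
  have hLne : W.leadingLCoeff ≠ 0 := W.leadingLCoeff_ne_zero_holds (hmod W)
  have hq0 : q ≠ 0 := by
    rintro rfl
    apply hLne
    rw [hq]
    simp
  refine ⟨q * (W.torsionOrder : ℚ) ^ 2 / (W.tamagawaProduct : ℚ), ?_, ?_⟩
  · rw [shaAn_def, hq]
    push_cast
    field_simp
  · have ht : (W.torsionOrder : ℚ) ≠ 0 := by exact_mod_cast ht0.ne'
    have hc : (W.tamagawaProduct : ℚ) ≠ 0 := by exact_mod_cast hc0.ne'
    rw [padicValRat.div (mul_ne_zero hq0 (pow_ne_zero 2 ht)) hc, padicValRat.mul hq0 (pow_ne_zero 2 ht),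
      padicValRat.pow (W.torsionOrder : ℚ), padicValRat.of_nat, padicValRat.of_nat,
      padicValNat_torsionOrder_eq_zero_of_irreducible W p hirr]
    push_cast at hv ⊢
    linarith

/-- **X6 ∧ `r_an = 1`, `p ≥ 3`: the typed residue `MissingLowerBoundAt W p` from JSW (eq:shalower).**
At an X6 pair (`GoodSS W p`, `Semistable W`, `5 ≤ p ∨ a_3 = 0`) with `ord_{s=1} L(E,s) = 1` and
`p ≥ 3`: the hypotheses of Jetchev–Skinner–Wan §7 hold — semistable over `𝓞 ℚ`
(`semistable_iff_isSemistable_ringOfIntegers`), good at `p`, the `p = 3` proviso from `a_3 = 0`,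
`E[p]` irreducible AUTOMATICALLY (Serre 1972 Prop. 12, `ClassX6.irr`), `Ш` finite (GZK `hGZK`) — so
the cited lower bound `h741` (`JetchevSkinnerWan2017.sec741_shaLowerBound_rank_one`; printed inputs
at a supersingular `p`: (α) → Castella–Liu–Wan 2022 Thm. 8.2.3 + Kato/Perrin-Riou for the twist, NOT
[wan:kobayashi]) gives `ord_p #Ш_an ≤ ord_p #Ш`. CONDITIONAL on the named fact `h741`.
[cite: JetchevSkinnerWan2017, §7.4.1 (eq:shalower), p. 31 of arXiv:1512.06894]
[cite: Serre1972, §1.11 Prop. 12] [cite: Miller2011LMS, Def. 1.1] -/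
theorem X6.missingLowerBoundAt_of_sec741_of_analyticRank_eq_one
    (h741 : JetchevSkinnerWan2017.sec741_shaLowerBound_rank_one)
    (hGZK : rank_eq_analyticRank_of_analyticRank_le_one) (hmod : hasEntireLFunction_rat)
    (W : WeierstrassCurve ℚ) [W.IsElliptic] [W.IsGloballyMinimal] (p : ℕ) [Fact p.Prime]
    (hp : 3 ≤ p) (hX : ClassX6 W p) (hr : W.analyticRank = 1) : MissingLowerBoundAt W p := by
  have hp2 : p ≠ 2 := by omega
  have hirr : Irr W p := ClassX6.irr W p hp2 hX
  obtain ⟨⟨hgood, _⟩, hsst, h5⟩ := hX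
  have hfin : Finite W.sha := (hGZK W hr.le).2
  have hsstO : W.IsSemistable (𝓞 ℚ) := (semistable_iff_isSemistable_ringOfIntegers W).mp hsst
  have h3 : p = 3 → (3 : ℤ) ∣ W.frobeniusTrace 3 → W.frobeniusTrace 3 = 0 := by
    rintro rfl -
    rcases h5 with h5 | h5
    · omega
    · exact h5
  exact missingLowerBoundAt_of_productShape_le W p hmod hirr (h741 W p hp hsstO hgood h3 hirr hr hfin)

/-- **X6 ∧ `r_an = 1`, `p ≥ 3`: the cell's typed missing input `X6.MissingInputAt W p` from the two
halves AS NAMED FACTS** — granted A155 = JSW (eq:shalower) (`h741`; PUB[α], flag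
`JSW17-741-ss-via-CLW22`: statement-match FAILS verbatim, referee R123.1 — at a supersingular `p` NOT
a published input under the cell's rule) for the lower half, and Sprung Cor. 1.3 (ii) (`hS`) for the
upper half (through `X6.missingInputAt_iff_missingLowerBoundAt_of_analyticRank_eq_one`). Bookkeeping in
the currency of `Typed/X6.lean`; CONDITIONAL on the two named facts; nothing booked.
[cite: JetchevSkinnerWan2017, §7.4.1 (eq:shalower), p. 31 of arXiv:1512.06894]
[cite: Sprung2024, Cor. 1.3 (p. 5), second sentence] [cite: Miller2011LMS, Def. 1.1] -/
theorem X6.missingInputAt_of_sec741_of_sprung_of_analyticRank_eq_one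
    (h741 : JetchevSkinnerWan2017.sec741_shaLowerBound_rank_one)
    (hS : Sprung2024.cor13_padicValRat_bsd_rank_one_le)
    (hGZK : rank_eq_analyticRank_of_analyticRank_le_one) (hmod : hasEntireLFunction_rat)
    (W : WeierstrassCurve ℚ) [W.IsElliptic] [W.IsGloballyMinimal] (p : ℕ) [Fact p.Prime]
    (hp : 3 ≤ p) (hX : ClassX6 W p) (hr : W.analyticRank = 1) : X6.MissingInputAt W p :=
  (X6.missingInputAt_iff_missingLowerBoundAt_of_analyticRank_eq_one W p hS hGZK hmod (by omega) hX hr).mpr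
    (X6.missingLowerBoundAt_of_sec741_of_analyticRank_eq_one h741 hGZK hmod W p hp hX hr)

/-- **X6 ∧ `r_an = 1`, `p ≥ 3`: `BSD(E,p)` GRANTED the named fact A155 (JSW (eq:shalower); PUB[α],
flag `JSW17-741-ss-via-CLW22`: statement-match FAILS verbatim, referee R123.1) and Sprung Cor. 1.3
(ii), without component (β) of `JSW-ss`.** Lower half: JSW 2017 §7.4.1 (eq:shalower) (`h741`; at a
supersingular `p` its printed input (α) = arXiv:1412.1767 is unpublished and its published successor
Castella–Liu–Wan FMS 10 (2022) Thm. 8.2.3 differs in hypotheses/conclusion ring — Δ1/Δ2 of R123.1 —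
and carries `Hid04-gap`; hence `h741` is NOT a published input there under the cell's rule). Upper
half: Sprung 2024 Cor. 1.3, second sentence (`hS`; `X6.missingUpperBoundAt_of_analyticRank_eq_one`,
flags `Sprung24-Cor13-via-Kob13` / `KOB13-primary-unread`). Plus GZK (`hGZK`) and modularity
(`hmod`). NOT consumed: JSW Thm. 1.2.1 as a whole, [wan:kobayashi] / Burungale–Skinner–Tian–Wan
Thm. 1.3/1.5, any rank-`0` `p`-part equality. CONDITIONAL on the two named facts; no label is moved
here (referee). [cite: JetchevSkinnerWan2017, §7.4.1 (eq:shalower), p. 31 of arXiv:1512.06894]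
[cite: Sprung2024, Cor. 1.3 (p. 5), second sentence] [cite: Miller2011LMS, §1 and Def. 1.1] -/
theorem X6.bsdp_of_sec741_of_sprung_of_analyticRank_eq_one
    (h741 : JetchevSkinnerWan2017.sec741_shaLowerBound_rank_one)
    (hS : Sprung2024.cor13_padicValRat_bsd_rank_one_le)
    (hGZK : rank_eq_analyticRank_of_analyticRank_le_one) (hmod : hasEntireLFunction_rat)
    (W : WeierstrassCurve ℚ) [W.IsElliptic] [W.IsGloballyMinimal] (p : ℕ) [Fact p.Prime]
    (hp : 3 ≤ p) (hX : ClassX6 W p) (hr : W.analyticRank = 1) : BSDp W p :=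
  X6.bsdp_of_missingLowerBoundAt_of_analyticRank_eq_one W p hS hGZK hmod (by omega) hX hr
    (X6.missingLowerBoundAt_of_sec741_of_analyticRank_eq_one h741 hGZK hmod W p hp hX hr)

/-- **Row C3 ∩ {supersingular at `p`}: `BSD(E,p)` from (eq:shalower) + Sprung Cor. 1.3 (ii).** A pair
in the census row C3 (`RowC3 W p`: `r_an = 1`, semistable, good at `p`, `E[p]` irreducible,
`5 ≤ p ∨ (p = 3 ∧ (ordinary ∨ a_3 = 0))`, `Partition/Rows.lean`) that is SUPERSINGULAR at `p`
(`GoodSS W p`) is an X6 pair with `p ≥ 3` (at `p = 3` the ordinary alternative contradicts `3 ∣ a_3`),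
so `X6.bsdp_of_sec741_of_sprung_of_analyticRank_eq_one` applies: the supersingular sub-row of C3 —
the one carrying the flag `JSW-ss` in RESIDUAL-CASES §a.1 — follows GRANTED the (β)-free named facts
`h741` (A155, JSW (eq:shalower); PUB[α], statement-match with published print FAILS verbatim at a
supersingular `p`, referee R123.1) and `hS` (Sprung) with GZK and modularity. CONDITIONAL; nothing is
booked; no label is moved here (X6 ∩ {r_an = 1} stays CONSTRUCTION-SHAPED).
[cite: JetchevSkinnerWan2017, §7.4.1 (eq:shalower), p. 31 of arXiv:1512.06894]
[cite: Sprung2024, Cor. 1.3 (p. 5), second sentence] [cite: Miller2011LMS, §1 and Def. 1.1] -/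
theorem RowC3.bsdp_of_goodSS_of_sec741_of_sprung
    (h741 : JetchevSkinnerWan2017.sec741_shaLowerBound_rank_one)
    (hS : Sprung2024.cor13_padicValRat_bsd_rank_one_le)
    (hGZK : rank_eq_analyticRank_of_analyticRank_le_one) (hmod : hasEntireLFunction_rat)
    (W : WeierstrassCurve ℚ) [W.IsElliptic] [W.IsGloballyMinimal] (p : ℕ) [Fact p.Prime]
    (h : RowC3 W p) (hss : GoodSS W p) : BSDp W p := by
  obtain ⟨hr, hsst, -, -, h5⟩ := h
  have hp : 3 ≤ p := by
    rcases h5 with h5 | ⟨h3, -⟩ <;> omega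
  have hX : ClassX6 W p := by
    refine ⟨hss, hsst, ?_⟩
    rcases h5 with h5 | ⟨rfl, h3⟩
    · exact Or.inl h5
    · rcases h3 with hord | h0
      · exact absurd hss.2 hord.2
      · exact Or.inr h0
  exact X6.bsdp_of_sec741_of_sprung_of_analyticRank_eq_one h741 hS hGZK hmod W p hp hX hr

end Summit.BirchSwinnertonDyer.Rank1Residual.Supersingular

end
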